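import Mathlib
import HarnessLib
import Summits.Ventures.LatticeQCDFlow.Scaling.KernelMarginalMTP2

/-!
# LatticeQCDFlow / Scaling — the exact autoregressive conditionals of a ferromagnet are STOCHASTICALLY
# MONOTONE in every context variable (TP₂ of the marginal kernel ⇒ monotone likelihood ratio ⇒
# first-order dominance): the exact triangular transport is a coordinatewise monotone map

HONEST FRAMING: exact (Metropolis-corrected) sampling algorithms for lattice gauge theory;
figures of merit are autocorrelation/cost numbers at stated couplings and volumes; no
continuum-physics claim.

Venture `LatticeQCDFlow` (cell pub-lqcd), topic `Scaling`, FANOUT row 30 (lean-1, GEN-17) — OUR WORK, a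
structural consequence of `Scaling/KernelMarginalMTP2` for THEORY-2 §4 (C5 / T2-AF: what an exact
autoregressive sampler of a lattice field must represent).  For a kernel `K(u, t) ≥ 0` on a linearly
ordered space that is TP₂ (`K(u,t')K(u',t) ≤ K(u,t)K(u',t')` for `u ≤ u'`, `t ≤ t'`) the normalised
conditional laws `K(·, t) dμ / ∫K(·,t)dμ` increase with `t` in the sense of first-order stochastic
dominance; applied to `K(u,t) = A_s w(φ[a ↦ u][j ↦ t])` (MTP₂ by `mtp2_coordAvg_pairBondWeight`):

* §1 **`tp2_tail_cross_le`** — for TP₂ non-negative `K` with integrable sections, every threshold `c`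
  and `t ≤ t'`: `(∫_{u > c} K(u,t)) · (∫ K(v,t')) ≤ (∫_{u > c} K(u,t')) · (∫ K(v,t))`
  (split `∫ = ∫_{≤ c} + ∫_{> c}`; the `> c × > c` parts agree; on `v ≤ c < u` the TP₂ inequality is
  pointwise); hence **`tp2_condTail_mono`**: the conditional tail probability
  `∫_{u>c} K(u,t) dμ / ∫ K(u,t) dμ` is non-decreasing in `t` (positive normalisers).
* §2 **`tp2_section_of_mtp2`** (with `update_update_sup` / `update_update_inf`) — the two-point
  sections `(u, t) ↦ N(φ[a ↦ u][j ↦ t])` (`j ≠ a`) of an MTP₂ function `N` are TP₂; used with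
  `N = A_s w` for a ferromagnetic pair-interaction weight (non-negative one-body factors, non-negative
  TP₂ bonds, bounded measurable) and ANY block `s` (`mtp2_coordAvg_pairBondWeight`).
* §3 **`arConditional_tail_mono`** — THE EXACT CONDITIONAL OF `φ_a` IS STOCHASTICALLY NON-DECREASING IN
  EVERY OTHER VARIABLE: with `N = A_s w`, for every threshold `c`, every configuration `φ` and
  `t ≤ t'`, `P(φ_a > c | φ[j ↦ t]) ≤ P(φ_a > c | φ[j ↦ t'])` where
  `P(φ_a > c | ψ) = ∫_{u>c} N(ψ[a↦u]) dμ(u) / ∫ N(ψ[a↦u]) dμ(u)` — for every block `s` (so for every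
  generation order and every step), every dimension, every graph; **`arConditional_tail_mono_of_pos`**
  discharges the integrability / positivity side conditions for strictly positive factors.

READING (value-free): for gradient-`φ⁴` / Gaussian / ferromagnetic pair interactions the exact
Knothe–Rosenblatt (triangular, autoregressive) transport `u ↦ F⁻¹_{a|context}` is MONOTONE in each
context coordinate as well as in `u`: monotone-network conditioners lose nothing for these targets, and
the sign of every context dependence is fixed a priori.  NOT CLAIMED: strict increase (that is C5's
faithfulness, `KernelCompositionTP2` in one dimension); non-ferromagnetic or gauge targets; any number
of ours.  Literature grade (cell rule): known mechanism (TP₂ ⇒ monotone likelihood ratio ⇒ stochastic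
order, Karlin–Rubin / Karlin–Rinott 1980 Thm 4.1) — typed here; no `def`; no `sorry`.
-/

noncomputable section

namespace Summit.Ventures.LatticeQCDFlow.Theory2.Autoregressive

open MeasureTheory Function Set
open Summit.Ventures.LatticeQCDFlow.Exactness

variable {X : Type*} [LinearOrder X] [MeasurableSpace X]

/-! ## §1 TP₂ kernels have stochastically monotone conditional laws -/

/-- **Cross inequality for tails of a TP₂ kernel**: `K` TP₂ with integrable sections, `t ≤ t'`,
any threshold `c` (the tail set `{u | c < u}` measurable):
`(∫_{u>c} K(u,t))·(∫ K(v,t')) ≤ (∫_{u>c} K(u,t'))·(∫ K(v,t))`. [folklore: Karlin–Rubin; typed here] -/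
theorem tp2_tail_cross_le (μ : Measure X) [SFinite μ] (K : X → X → ℝ)
    (hK : ∀ u u' t t', u ≤ u' → t ≤ t' → K u t' * K u' t ≤ K u t * K u' t')
    (hint : ∀ t, Integrable (fun u => K u t) μ) {c : X} (hc : MeasurableSet {u | c < u}) {t t' : X}
    (htt : t ≤ t') :
    (∫ u in {u | c < u}, K u t ∂μ) * (∫ v, K v t' ∂μ) ≤
      (∫ u in {u | c < u}, K u t' ∂μ) * (∫ v, K v t ∂μ) := by
  -- indicator form of the tail integrals
  set A : Set X := {u | c < u} with hA
  have htail : ∀ r, ∫ u in A, K u r ∂μ = ∫ u, A.indicator (fun u => K u r) u ∂μ := fun r =>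
    (integral_indicator hc).symm
  have hsplit : ∀ r, ∫ v, K v r ∂μ =
      (∫ v, A.indicator (fun v => K v r) v ∂μ) + ∫ v, Aᶜ.indicator (fun v => K v r) v ∂μ := by
    intro r
    rw [← integral_add ((hint r).indicator hc) ((hint r).indicator hc.compl)]
    refine integral_congr_ae (ae_of_all _ fun v => ?_)
    by_cases hv : v ∈ A
    · simp [Set.indicator_of_mem hv, Set.indicator_of_notMem (Set.notMem_compl_iff.2 hv)]
    · simp [Set.indicator_of_notMem hv, Set.indicator_of_mem (Set.mem_compl hv)]
  rw [htail, htail, hsplit t', hsplit t, mul_add, mul_add]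
  have hcomm : (∫ u, A.indicator (fun u => K u t) u ∂μ) * (∫ v, A.indicator (fun v => K v t') v ∂μ) =
      (∫ u, A.indicator (fun u => K u t') u ∂μ) * (∫ v, A.indicator (fun v => K v t) v ∂μ) :=
    mul_comm _ _
  -- the cross terms: `(∫_A K(·,t))(∫_{Aᶜ} K(·,t')) ≤ (∫_A K(·,t'))(∫_{Aᶜ} K(·,t))`, pointwise on `A × Aᶜ`
  have hcross : (∫ u, A.indicator (fun u => K u t) u ∂μ) * (∫ v, Aᶜ.indicator (fun v => K v t') v ∂μ) ≤
      (∫ u, A.indicator (fun u => K u t') u ∂μ) * (∫ v, Aᶜ.indicator (fun v => K v t) v ∂μ) := by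
    rw [← integral_prod_mul (μ := μ) (ν := μ), ← integral_prod_mul (μ := μ) (ν := μ)]
    refine integral_mono (((hint t).indicator hc).mul_prod ((hint t').indicator hc.compl))
      (((hint t').indicator hc).mul_prod ((hint t).indicator hc.compl)) fun p => ?_
    by_cases h1 : p.1 ∈ A
    · by_cases h2 : p.2 ∈ Aᶜ
      · simp only [Set.indicator_of_mem h1, Set.indicator_of_mem h2]
        -- `p.2 ≤ c < p.1`, `t ≤ t'`: TP₂ with `u = p.2 ≤ u' = p.1`
        have hle : p.2 ≤ p.1 := (le_of_not_gt (fun h => h2 h)).trans (le_of_lt h1)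
        have := hK p.2 p.1 t t' hle htt
        nlinarith [this, mul_comm (K p.1 t) (K p.2 t'), mul_comm (K p.1 t') (K p.2 t)]
      · simp [Set.indicator_of_notMem h2]
    · simp [Set.indicator_of_notMem h1]
  linarith [hcomm, hcross]

/-- **Monotone conditional tails**: under the hypotheses of `tp2_tail_cross_le`, with positive
normalisers, `t ≤ t'` ⇒ `∫_{u>c}K(u,t)/∫K(u,t) ≤ ∫_{u>c}K(u,t')/∫K(u,t')` — first-order stochastic
monotonicity of the conditional laws of a TP₂ kernel. [folklore; typed here] -/
theorem tp2_condTail_mono (μ : Measure X) [SFinite μ] (K : X → X → ℝ)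
    (hK : ∀ u u' t t', u ≤ u' → t ≤ t' → K u t' * K u' t ≤ K u t * K u' t')
    (hint : ∀ t, Integrable (fun u => K u t) μ) (hpos : ∀ t, 0 < ∫ u, K u t ∂μ) {c : X}
    (hc : MeasurableSet {u | c < u}) {t t' : X} (htt : t ≤ t') :
    (∫ u in {u | c < u}, K u t ∂μ) / (∫ u, K u t ∂μ) ≤
      (∫ u in {u | c < u}, K u t' ∂μ) / (∫ u, K u t' ∂μ) := by
  rw [div_le_div_iff₀ (hpos t) (hpos t')]
  exact tp2_tail_cross_le μ K hK hint hc htt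

/-! ## §2 Two-point sections of partial averages of ferromagnetic weights are TP₂ -/

variable {κ : Type*} [Fintype κ] [DecidableEq κ]

omit [MeasurableSpace X] [Fintype κ] in
/-- `φ[a ↦ u][j ↦ t'] ⊔ φ[a ↦ u'][j ↦ t] = φ[a ↦ u'][j ↦ t']` for `u ≤ u'`, `t ≤ t'`, `j ≠ a`. [ours] -/
theorem update_update_sup (φ : κ → X) {a j : κ} (hja : j ≠ a) {u u' t t' : X} (hu : u ≤ u')
    (ht : t ≤ t') :
    update (update φ a u) j t' ⊔ update (update φ a u') j t = update (update φ a u') j t' := by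
  funext i
  simp only [Pi.sup_apply]
  by_cases hij : i = j
  · subst hij; simp [sup_eq_left.2 ht]
  · by_cases hia : i = a
    · subst hia; simp [update_of_ne hij, sup_eq_right.2 hu]
    · simp [update_of_ne hij, update_of_ne hia]

omit [MeasurableSpace X] [Fintype κ] in
/-- `φ[a ↦ u][j ↦ t'] ⊓ φ[a ↦ u'][j ↦ t] = φ[a ↦ u][j ↦ t]` for `u ≤ u'`, `t ≤ t'`, `j ≠ a`. [ours] -/
theorem update_update_inf (φ : κ → X) {a j : κ} (hja : j ≠ a) {u u' t t' : X} (hu : u ≤ u')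
    (ht : t ≤ t') :
    update (update φ a u) j t' ⊓ update (update φ a u') j t = update (update φ a u) j t := by
  funext i
  simp only [Pi.inf_apply]
  by_cases hij : i = j
  · subst hij; simp [inf_eq_right.2 ht]
  · by_cases hia : i = a
    · subst hia; simp [update_of_ne hij, inf_eq_left.2 hu]
    · simp [update_of_ne hij, update_of_ne hia]

omit [MeasurableSpace X] [Fintype κ] in
/-- **Two-point sections of an MTP₂ weight are TP₂**: if `N` satisfies the lattice condition then
`(u, t) ↦ N(φ[a ↦ u][j ↦ t])` is TP₂ (`j ≠ a`). [ours] -/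
theorem tp2_section_of_mtp2 {N : (κ → X) → ℝ} (hN : ∀ x y, N x * N y ≤ N (x ⊔ y) * N (x ⊓ y))
    (φ : κ → X) {a j : κ} (hja : j ≠ a) (u u' t t' : X) (hu : u ≤ u') (ht : t ≤ t') :
    N (update (update φ a u) j t') * N (update (update φ a u') j t) ≤
      N (update (update φ a u) j t) * N (update (update φ a u') j t') := by
  have h := hN (update (update φ a u) j t') (update (update φ a u') j t)
  rw [update_update_sup φ hja hu ht, update_update_inf φ hja hu ht, mul_comm (N (update (update φ a u') j t'))]
    at h
  exact h

/-! ## §3 The exact conditional of `φ_a` is stochastically monotone in every other variable -/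

/-- **STOCHASTIC MONOTONICITY OF THE EXACT AUTOREGRESSIVE CONDITIONALS OF A FERROMAGNET.**  Weight
`w(x) = ∏_i g_i(x_i)·∏_e b_e(x_{src e}, x_{tgt e})` with non-negative bounded measurable one-body
factors and non-negative bounded measurable TP₂ bonds, any reference probability measure, ANY block `s`
of integrated variables, `N = A_s w`, `j ≠ a`; assume the sections `u ↦ N(φ[a↦u][j↦t])` integrable
with positive integral (e.g. everything positive) and the tail `{u | c < u}` measurable.  Then for
`t ≤ t'`: `∫_{u>c} N(φ[a↦u][j↦t]) / ∫ N(φ[a↦u][j↦t]) ≤ ∫_{u>c} N(φ[a↦u][j↦t']) / ∫ N(φ[a↦u][j↦t'])`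
— the exact conditional tail probability of `φ_a` is non-decreasing in `φ_j`. [ours] -/
theorem arConditional_tail_mono {η : Type*} (μ : Measure X) [IsProbabilityMeasure μ] (E : Finset η)
    (src tgt : η → κ) (b : η → X → X → ℝ) (g : κ → X → ℝ) (hgm : ∀ i, Measurable (g i))
    (hbm : ∀ e, Measurable (uncurry (b e))) (hg0 : ∀ i u, 0 ≤ g i u) (hb0 : ∀ e u v, 0 ≤ b e u v)
    (hgC : ∀ i, ∃ C, ∀ u, g i u ≤ C) (hbC : ∀ e, ∃ C, ∀ u v, b e u v ≤ C)
    (hb : ∀ e u u' v v', u ≤ u' → v ≤ v' → b e u' v * b e u v' ≤ b e u v * b e u' v')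
    (s : Finset κ) (φ : κ → X) {a j : κ} (hja : j ≠ a)
    (hint : ∀ t, Integrable (fun u => coordAvg μ s
      (fun x => (∏ i, g i (x i)) * ∏ e ∈ E, b e (x (src e)) (x (tgt e))) (update (update φ a u) j t)) μ)
    (hpos : ∀ t, 0 < ∫ u, coordAvg μ s
      (fun x => (∏ i, g i (x i)) * ∏ e ∈ E, b e (x (src e)) (x (tgt e))) (update (update φ a u) j t) ∂μ)
    {c : X} (hc : MeasurableSet {u | c < u}) {t t' : X} (htt : t ≤ t') :
    (∫ u in {u | c < u}, coordAvg μ s (fun x => (∏ i, g i (x i)) * ∏ e ∈ E, b e (x (src e)) (x (tgt e)))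
        (update (update φ a u) j t) ∂μ) /
      (∫ u, coordAvg μ s (fun x => (∏ i, g i (x i)) * ∏ e ∈ E, b e (x (src e)) (x (tgt e)))
        (update (update φ a u) j t) ∂μ) ≤
    (∫ u in {u | c < u}, coordAvg μ s (fun x => (∏ i, g i (x i)) * ∏ e ∈ E, b e (x (src e)) (x (tgt e)))
        (update (update φ a u) j t') ∂μ) /
      (∫ u, coordAvg μ s (fun x => (∏ i, g i (x i)) * ∏ e ∈ E, b e (x (src e)) (x (tgt e)))
        (update (update φ a u) j t') ∂μ) := by
  set w : (κ → X) → ℝ := fun x => (∏ i, g i (x i)) * ∏ e ∈ E, b e (x (src e)) (x (tgt e)) with hw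
  have hmtp := mtp2_coordAvg_pairBondWeight μ E src tgt b g hgm hbm hg0 hb0 hgC hbC hb s
  refine tp2_condTail_mono μ (fun u t => coordAvg μ s w (update (update φ a u) j t))
    (fun u u' r r' hu hr => ?_) hint hpos hc htt
  exact tp2_section_of_mtp2 (N := coordAvg μ s w) (fun x y => hmtp x y) φ hja u u' r r' hu hr

/-- **The same with the side conditions discharged**: strictly positive bounded measurable one-body
factors and TP₂ bonds, any reference probability measure — for every block `s`, `j ≠ a`, measurable
tail `{u | c < u}` and `t ≤ t'`, the exact conditional tail probability of `φ_a` is non-decreasing in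
`φ_j`. [ours] -/
theorem arConditional_tail_mono_of_pos {η : Type*} (μ : Measure X) [IsProbabilityMeasure μ]
    (E : Finset η) (src tgt : η → κ) (b : η → X → X → ℝ) (g : κ → X → ℝ)
    (hgm : ∀ i, Measurable (g i)) (hbm : ∀ e, Measurable (uncurry (b e)))
    (hgpos : ∀ i u, 0 < g i u) (hbpos : ∀ e u v, 0 < b e u v) (hgC : ∀ i, ∃ C, ∀ u, g i u ≤ C)
    (hbC : ∀ e, ∃ C, ∀ u v, b e u v ≤ C)
    (hb : ∀ e u u' v v', u ≤ u' → v ≤ v' → b e u' v * b e u v' ≤ b e u v * b e u' v')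
    (s : Finset κ) (φ : κ → X) {a j : κ} (hja : j ≠ a) {c : X} (hc : MeasurableSet {u | c < u})
    {t t' : X} (htt : t ≤ t') :
    (∫ u in {u | c < u}, coordAvg μ s (fun x => (∏ i, g i (x i)) * ∏ e ∈ E, b e (x (src e)) (x (tgt e)))
        (update (update φ a u) j t) ∂μ) /
      (∫ u, coordAvg μ s (fun x => (∏ i, g i (x i)) * ∏ e ∈ E, b e (x (src e)) (x (tgt e)))
        (update (update φ a u) j t) ∂μ) ≤
    (∫ u in {u | c < u}, coordAvg μ s (fun x => (∏ i, g i (x i)) * ∏ e ∈ E, b e (x (src e)) (x (tgt e)))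
        (update (update φ a u) j t') ∂μ) /
      (∫ u, coordAvg μ s (fun x => (∏ i, g i (x i)) * ∏ e ∈ E, b e (x (src e)) (x (tgt e)))
        (update (update φ a u) j t') ∂μ) := by
  set w : (κ → X) → ℝ := fun x => (∏ i, g i (x i)) * ∏ e ∈ E, b e (x (src e)) (x (tgt e)) with hw
  have hwpos : ∀ x, 0 < w x := fun x =>
    mul_pos (Finset.prod_pos fun i _ => hgpos i _) (Finset.prod_pos fun e _ => hbpos e _ _)
  have hwm : Measurable w :=
    (Finset.measurable_prod _ fun i _ => (hgm i).comp (measurable_pi_apply i)).mul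
      (Finset.measurable_prod _ fun e _ =>
        show Measurable (uncurry (b e) ∘ fun x : κ → X => (x (src e), x (tgt e))) from
          (hbm e).comp ((measurable_pi_apply _).prodMk (measurable_pi_apply _)))
  obtain ⟨Cg, hCg⟩ : ∃ Cg : κ → ℝ, ∀ i u, g i u ≤ Cg i := ⟨fun i => (hgC i).choose, fun i => (hgC i).choose_spec⟩
  obtain ⟨Cb, hCb⟩ : ∃ Cb : η → ℝ, ∀ e u v, b e u v ≤ Cb e :=
    ⟨fun e => (hbC e).choose, fun e => (hbC e).choose_spec⟩
  set C : ℝ := (∏ i, Cg i) * ∏ e ∈ E, Cb e with hCdef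
  have hwC : ∀ x, w x ≤ C := fun x =>
    mul_le_mul (Finset.prod_le_prod (fun i _ => (hgpos i _).le) fun i _ => hCg i _)
      (Finset.prod_le_prod (fun e _ => (hbpos e _ _).le) fun e _ => hCb e _ _)
      (Finset.prod_nonneg fun e _ => (hbpos e _ _).le)
      (Finset.prod_nonneg fun i _ => (hgpos i (x i)).le.trans (hCg i _))
  have hNm : Measurable (coordAvg μ s w) := by
    have hm : Measurable fun p : (κ → X) × (κ → X) => w (s.piecewise p.2 p.1) :=
      hwm.comp (measurable_piecewise_prod s)
    exact (hm.stronglyMeasurable.integral_prod_right' (ν := Measure.pi fun _ : κ => μ)).measurable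
  have hNpos : ∀ x, 0 < coordAvg μ s w x := fun x =>
    coordAvg_pos_of_pos μ s hwpos x (Integrable.mono' (integrable_const C)
      ((hwm.comp (measurable_piecewise_left s x)).aestronglyMeasurable)
      (ae_of_all _ fun η' => by rw [Real.norm_eq_abs, abs_of_pos (hwpos _)]; exact hwC _))
  have hNC : ∀ x, coordAvg μ s w x ≤ C := fun x => by
    unfold coordAvg
    calc (∫ ω', w (s.piecewise ω' x) ∂Measure.pi fun _ : κ => μ)
        ≤ ∫ _, C ∂Measure.pi fun _ : κ => μ :=
          integral_mono_of_nonneg (ae_of_all _ fun _ => (hwpos _).le) (integrable_const C)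
            (ae_of_all _ fun ω' => hwC _)
      _ = C := by simp
  have hupd : ∀ r : X, Measurable fun u : X => update (update φ a u) j r := fun r =>
    (measurable_update'.comp (measurable_id.prodMk measurable_const)).comp (measurable_update φ)
  have hsec : ∀ r, Integrable (fun u => coordAvg μ s w (update (update φ a u) j r)) μ := fun r =>
    Integrable.mono' (integrable_const C) ((hNm.comp (hupd r)).aestronglyMeasurable)
      (ae_of_all _ fun u => by rw [Real.norm_eq_abs, abs_of_pos (hNpos _)]; exact hNC _)
  have hposI : ∀ r, 0 < ∫ u, coordAvg μ s w (update (update φ a u) j r) ∂μ := fun r => by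
    rw [integral_pos_iff_support_of_nonneg (fun u => (hNpos _).le) (hsec r)]
    have : Function.support (fun u => coordAvg μ s w (update (update φ a u) j r)) = Set.univ :=
      Set.eq_univ_of_forall fun u => (hNpos _).ne'
    rw [this, measure_univ]; exact one_pos
  exact arConditional_tail_mono μ E src tgt b g hgm hbm (fun i u => (hgpos i u).le)
    (fun e u v => (hbpos e u v).le) (fun i => ⟨Cg i, hCg i⟩) (fun e => ⟨Cb e, hCb e⟩) hb s φ hja
    hsec hposI hc htt

end Summit.Ventures.LatticeQCDFlow.Theory2.Autoregressive

end
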